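import Summits.HodgeConjecture.HodgeConjecture.Theorems.F0P5TP2HermAssemblyAntihol
import HarnessLib

/-!
# Crux `HLiu418` — the P5 floor-0 named facts TP₂ (D₂) ∕ (D̄₂) ARE THEOREMS: `holCotFormSpectralProjection₂_holds`,
# `antiholCotFormSpectralProjection₂_holds`

HC_CM is proved only modulo the printed citations until rung 0 closes.  Cell `hodgecm-mathlib`, floor 0, programme P5.  After the R1 (α-lite)
in-place edition of the TP₂ letters (★ `Literature/NumberTheory/Automorphic/UnitaryCurveCotangentSpectralProjection.lean` ed. 3: ONE binder
`(H.map (cmPlace L ι).1.embedding).IsHermitian →` after `hg` in both (D₂) letters), the letters are token-identical to the types of ★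
`F0P5TP2HermAssembly.holCotFormSpectralProjection₂Herm_holds` ∕ `antiholCotFormSpectralProjection₂Herm_holds` (the K-lane sub-line
`Lines/F0_P5TP2SpectralProjection.lean`, stubs (K₂)(S₂)(H₂)(R₂)(G₂)(T₂) all ★), which therefore DISCHARGE the two named facts by `exact`.
THEOREMS ONLY; no definition, no instance, no `sorry`.

## References
* [Borel1997] A. Borel, *Automorphic forms on SL₂(ℝ)*, Cambridge Tracts in Math. 130 (1997), Thm. 2.13, §5.14.
* [BorelJacquet1979] A. Borel, H. Jacquet, *Automorphic forms and automorphic representations*, PSPM 33.1 (1979), §4.6.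
-/

set_option autoImplicit false
set_option linter.dupNamespace false -- the mandated namespace repeats `HodgeConjecture.HodgeConjecture`

namespace Summit.HodgeConjecture.HodgeConjecture.Cruxes.HLiu418.F0P5TP2Holds

open Literature.NumberTheory.Automorphic.UnitaryCurveForms
open Summit.HodgeConjecture.HodgeConjecture.Cruxes.HLiu418.F0P5TP2HermAssembly

/-- **TP₂ (D₂) — the spectral projection of a square-integrable cone-holomorphic cotangent form of the unitary Shimura curve is the class of a
cone-holomorphic cotangent form**: the named fact ★ `UnitaryCurveForms.holCotFormSpectralProjection₂` (ed. 3) HOLDS.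
[cite: Borel1997, Thm. 2.13 and §5.14] [cite: BorelJacquet1979, §4.6] -/
theorem holCotFormSpectralProjection₂_holds : holCotFormSpectralProjection₂ :=
  holCotFormSpectralProjection₂Herm_holds

/-- **TP₂ (D̄₂) — the antiholomorphic twin**: ★ `UnitaryCurveForms.antiholCotFormSpectralProjection₂` (ed. 3) HOLDS.
[cite: BorelJacquet1979, §4.6] [cite: BorelWallach2000, VII 2.10] -/
theorem antiholCotFormSpectralProjection₂_holds : antiholCotFormSpectralProjection₂ :=
  antiholCotFormSpectralProjection₂Herm_holds

end Summit.HodgeConjecture.HodgeConjecture.Cruxes.HLiu418.F0P5TP2Holds
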